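import Summits.PneNP.PneNP.Theses.Descriptive

/-!
# Route Descriptive — support `NoPOptimalGivesPneNP` (stmt-PneNP-9122)

`NoPOptimalTaut → PneNP`: if `TAUT` has no p-optimal Cook–Reckhow proof system then `P ≠ NP`.
This is literally the route's deciding theorem `Summit.PneNP.PneNP.Theses.Descriptive.closes`
(proved in the route file: under `P = NP` the polynomial-time `TAUT`-decider, ignoring proofs, is a
proof system p-simulating every proof system for `TAUT`; Krajíček–Pudlák 1989 §1, Chen–Flum 2010 §1).
-/

set_option linter.dupNamespace false -- `Summit.PneNP.PneNP.…`: summit = sub-problem name (D-0017 single-conjunct layout)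

namespace Summit.PneNP.PneNP.Theorems

/-- **Support item `NoPOptimalGivesPneNP` (stmt-PneNP-9122)**: `NoPOptimalTaut → PneNP`, by the
route's deciding theorem `Descriptive.closes` (if `P = NP`, the polynomial-time decider of `TAUT`
is a p-optimal proof system). [Krajíček–Pudlák 1989, §1; Chen–Flum 2010, §1] -/
theorem descriptive_noPOptimalGivesPneNP_proof :
    Summit.PneNP.PneNP.Theses.Descriptive.NoPOptimalGivesPneNP := by
  unfold Summit.PneNP.PneNP.Theses.Descriptive.NoPOptimalGivesPneNP
  exact fun hT => Summit.PneNP.PneNP.Theses.Descriptive.closes hT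

end Summit.PneNP.PneNP.Theorems
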